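import Mathlib
import Literature.Probability.LatticeModels.TemperleyLiebBaxterization
import Literature.Probability.Percolation.DiagonalColumnPatterns
import Literature.Probability.Percolation.DiagonalStripTransferInhomogeneous
import Literature.Probability.Percolation.DiagonalStripTransferInterlacingTwoRow
import Literature.Probability.Percolation.DiagonalStripTLAction
import Literature.Probability.Percolation.DiagonalStripLumping
import Literature.Probability.Percolation.DiagonalStripPlanarity
import Literature.Probability.Percolation.DiagonalStripQKZPropagation
import Literature.Probability.Percolation.DiagonalStripGenericRapidities
import Literature.Probability.Percolation.DiagonalStripGenericSwap
import Literature.Probability.Percolation.DiagonalStripGenericInversion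
import Literature.Probability.Percolation.DiagonalStripGenericQKZ
import Literature.Probability.Percolation.DiagonalStripGenericSimplicity
import HarnessLib

/-!
# The generic ground state of `t(w; z⃗)` solves the boundary qKZ system up to scalars

Topic `Literature/Probability/Percolation`. Ikhlef–Ponsaing (J. Stat. Phys. 149 (2012),
arXiv:1202.5476) §3.4: "Since the ground state is unique, the interlacing relations yield the qKZ
equation … in the form `Ř_i(z_i/z_{i+1})Ψ = π_iΨ`, `Ψ(1/z_1,…) = Ψ`, `Ψ(…,1/z_L) = Ψ`" (after a
normalisation of `Ψ`). This file proves the normalisation-free content of that sentence for the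
generic ground state `Ψ` of `DiagonalStripGenericSimplicity.lean` (any nonzero `t`-fixed vector over
`Frac ℂ[w, z_1, …]`): **`groundState_exchange_odd_upToScalar`**, **`groundState_exchange_even_upToScalar`**
— for every level `i` there is a scalar `c_i` with
`[q z_{i+1}/z_i] Ψ(Q) - [z_i/z_{i+1}] Σ_{e_i Q₀ ≡ Q} Ψ(Q₀) = c_i σ_i(Ψ(Q))` — and
**`groundState_reflect_upToScalar`** — `Ψ` is an eigenvector of both boundary reflections
`genInv 1`, `genInv (2m+1)`; and **`groundState_support`** — `Ψ` is supported on valid planar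
lump-fixed patterns, i.e. on the connectivity basis `LP_L` (`ncStateEquiv`). Ingredients: the interlacing relations propagate fixed vectors
(`fixed_exchange_odd/_even`, from `exchange_propagate` and Lemma 3.2), the swap/inversion
(auto/endo)morphisms intertwine `t(w; z⃗)` with `t(w; s_i z⃗)` resp. itself, and generic
simplicity (`ipTransferMatrixW_fixed_proportional`). Pinning the scalars (`c_i = [q z_i/z_{i+1}]`,
eigenvalues `1`) is the normalisation statement of IP12 and is not proved here.

## References

* Y. Ikhlef, A. K. Ponsaing, J. Stat. Phys. 149 (2012) 10–36, arXiv:1202.5476, §3.4.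
  [IkhlefPonsaing2012]
-/

namespace Literature.Probability.Percolation

open Literature.Probability.LatticeModels

variable {m : ℕ}

/-! ### The generic ground state satisfies the boundary qKZ system up to scalars -/

section ProjectiveQKZ

open Literature.Probability.LatticeModels.TemperleyLieb

variable {K₀ : Type*} [Field K₀]

/-- A vector fixed by `t(w; z⃗)` is supported on valid patterns. [folklore] -/
theorem isValid_of_fixed_ne_zero {q : K₀} {ψ : ColPattern m → RapidityField K₀}
    (hψ : ∀ Q', ∑ Q, ipTransferMatrixW m (genC K₀ q) (genW K₀) (genZ K₀) Q Q' * ψ Q = ψ Q') {Q : ColPattern m}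
    (h : ψ Q ≠ 0) : IsValid 0 Q := by
  rw [← hψ Q] at h
  obtain ⟨P, -, hP⟩ := Finset.exists_ne_zero_of_sum_ne_zero h
  have ht : ipTransferMatrixW m (genC K₀ q) (genW K₀) (genZ K₀) P Q ≠ 0 := left_ne_zero_of_mul hP
  rw [ipTransferMatrixW_eq] at ht
  obtain ⟨P₁, -, hP₁⟩ := Finset.exists_ne_zero_of_sum_ne_zero ht
  obtain ⟨P₂, hP₂, hP₂'⟩ := Finset.exists_ne_zero_of_sum_ne_zero hP₁
  have hv := isValid_of_ipTransferW_ne_zero (right_ne_zero_of_mul hP₂')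
  rw [← (Finset.mem_filter.1 hP₂).2]
  exact isValid_zero_of_isValid_two (by simpa using lump_isValid hv)

/-- **Propagation of a fixed vector through the odd interlacing relation**: with
`Φ(Q) := [q z_{i+1}/z_i] ψ(Q) - [z_i/z_{i+1}] Σ_{e_i Q₀ ≡ Q} ψ(Q₀)` (`i = 2j+1`), if `ψ` is fixed by
`t(w; z⃗)` then `Φ` is fixed by `t(w; s_i z⃗)`. [cite: IkhlefPonsaing2012, §3.4] -/
theorem fixed_exchange_odd {q : K₀} (hq : q ^ 2 + q + 1 = 0) {ψ : ColPattern m → RapidityField K₀}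
    (hψ : ∀ Q', ∑ Q, ipTransferMatrixW m (genC K₀ q) (genW K₀) (genZ K₀) Q Q' * ψ Q = ψ Q')
    (j j1 : Fin (m + 1)) (hj1 : (j1 : ℕ) = j + 1) (Q'' : ColPattern m) :
    ∑ Q, ipTransferMatrixW m (genC K₀ q) (genW K₀) (zswap (genZ K₀) (2 * j + 1)) Q Q'' *
        (qbr (genC K₀ q * genZ K₀ (2 * j + 2) / genZ K₀ (2 * j + 1)) * ψ Q -
          qbr (genZ K₀ (2 * j + 1) / genZ K₀ (2 * j + 2)) *
            ∑ Q₀ ∈ Finset.univ.filter (fun Q₀ => lump (cpJoin j j1 Q₀) = Q), ψ Q₀) =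
      qbr (genC K₀ q * genZ K₀ (2 * j + 2) / genZ K₀ (2 * j + 1)) * ψ Q'' -
        qbr (genZ K₀ (2 * j + 1) / genZ K₀ (2 * j + 2)) *
          ∑ Q₀ ∈ Finset.univ.filter (fun Q₀ => lump (cpJoin j j1 Q₀) = Q''), ψ Q₀ := by
  have h := exchange_propagate (S := ColPattern m) (γ := 1)
    (t := ipTransferMatrixW m (genC K₀ q) (genW K₀) (genZ K₀))
    (t' := ipTransferMatrixW m (genC K₀ q) (genW K₀) (zswap (genZ K₀) (2 * j + 1)))
    (g := cpJoin j j1) (ℓ := lump)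
    (α := qbr (genC K₀ q * genZ K₀ (2 * j + 2) / genZ K₀ (2 * j + 1)))
    (β := qbr (genZ K₀ (2 * j + 1) / genZ K₀ (2 * j + 2))) (ψ := ψ)
    (ψ' := fun Q => qbr (genC K₀ q * genZ K₀ (2 * j + 2) / genZ K₀ (2 * j + 1)) * ψ Q -
          qbr (genZ K₀ (2 * j + 1) / genZ K₀ (2 * j + 2)) *
            ∑ Q₀ ∈ Finset.univ.filter (fun Q₀ => lump (cpJoin j j1 Q₀) = Q), ψ Q₀)
    (V := IsValid 0)
    (fun Q hQ Q'' => ipTransferMatrixW_interlace_odd_generic hq j j1 hj1 hQ Q'')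
    (fun Q => by rw [one_mul]) (fun Q hQ => isValid_of_fixed_ne_zero hψ hQ)
    (fun P Q'' => by rw [ipTransferMatrixW_eq, ipTransferMatrixW_eq, ipTwoLayerW_lump_input]) Q''
  rw [one_mul] at h
  rw [← h, hψ Q'']
  congr 1
  congr 1
  exact Finset.sum_congr rfl fun Q' _ => hψ Q'

/-- The same through the even interlacing relation (`i = 2b`). [cite: IkhlefPonsaing2012, §3.4] -/
theorem fixed_exchange_even {q : K₀} (hq : q ^ 2 + q + 1 = 0) {ψ : ColPattern m → RapidityField K₀}
    (hψ : ∀ Q', ∑ Q, ipTransferMatrixW m (genC K₀ q) (genW K₀) (genZ K₀) Q Q' * ψ Q = ψ Q')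
    (b0 b : Fin (m + 1)) (hb0 : (b : ℕ) = b0 + 1) (Q'' : ColPattern m) :
    ∑ Q, ipTransferMatrixW m (genC K₀ q) (genW K₀) (zswap (genZ K₀) (2 * b)) Q Q'' *
        (qbr (genC K₀ q * genZ K₀ (2 * b + 1) / genZ K₀ (2 * b)) * ψ Q -
          qbr (genZ K₀ (2 * b) / genZ K₀ (2 * b + 1)) *
            ∑ Q₀ ∈ Finset.univ.filter (fun Q₀ => lump (cpIsolate b Q₀) = Q), ψ Q₀) =
      qbr (genC K₀ q * genZ K₀ (2 * b + 1) / genZ K₀ (2 * b)) * ψ Q'' -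
        qbr (genZ K₀ (2 * b) / genZ K₀ (2 * b + 1)) *
          ∑ Q₀ ∈ Finset.univ.filter (fun Q₀ => lump (cpIsolate b Q₀) = Q''), ψ Q₀ := by
  have h := exchange_propagate (S := ColPattern m) (γ := 1)
    (t := ipTransferMatrixW m (genC K₀ q) (genW K₀) (genZ K₀))
    (t' := ipTransferMatrixW m (genC K₀ q) (genW K₀) (zswap (genZ K₀) (2 * b)))
    (g := cpIsolate b) (ℓ := lump)
    (α := qbr (genC K₀ q * genZ K₀ (2 * b + 1) / genZ K₀ (2 * b)))
    (β := qbr (genZ K₀ (2 * b) / genZ K₀ (2 * b + 1))) (ψ := ψ)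
    (ψ' := fun Q => qbr (genC K₀ q * genZ K₀ (2 * b + 1) / genZ K₀ (2 * b)) * ψ Q -
          qbr (genZ K₀ (2 * b) / genZ K₀ (2 * b + 1)) *
            ∑ Q₀ ∈ Finset.univ.filter (fun Q₀ => lump (cpIsolate b Q₀) = Q), ψ Q₀)
    (V := IsValid 0)
    (fun Q hQ Q'' => ipTransferMatrixW_interlace_even_generic hq b0 b hb0 hQ Q'')
    (fun Q => by rw [one_mul]) (fun Q hQ => isValid_of_fixed_ne_zero hψ hQ)
    (fun P Q'' => by rw [ipTransferMatrixW_eq, ipTransferMatrixW_eq, ipTwoLayerW_lump_input]) Q''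
  rw [one_mul] at h
  rw [← h, hψ Q'']
  congr 1
  congr 1
  exact Finset.sum_congr rfl fun Q' _ => hψ Q'

/-- **Pulling back by the swap**: if `Φ` is fixed by `t(w; s_i z⃗)` then `σ_i⁻¹ Φ` is fixed by
`t(w; z⃗)` (`i ≥ 1`). [folklore] -/
theorem fixed_genSwap_symm {q : K₀} {i : ℕ} (hi : i ≠ 0) {Φ : ColPattern m → RapidityField K₀}
    (hΦ : ∀ Q', ∑ Q, ipTransferMatrixW m (genC K₀ q) (genW K₀) (zswap (genZ K₀) i) Q Q' * Φ Q = Φ Q') (Q' : ColPattern m) :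
    ∑ Q, ipTransferMatrixW m (genC K₀ q) (genW K₀) (genZ K₀) Q Q' * (genSwap K₀ i).symm (Φ Q) =
      (genSwap K₀ i).symm (Φ Q') := by
  apply (genSwap K₀ i).injective
  rw [RingEquiv.apply_symm_apply, map_sum, ← hΦ Q']
  refine Finset.sum_congr rfl fun Q _ => ?_
  rw [map_mul, RingEquiv.apply_symm_apply, genSwap_ipTransferMatrixW hi]

/-- **Reflected fixed vectors are fixed** (top reflection `z_L → 1/z_L`). [folklore] -/
theorem fixed_genInv_top {q : K₀} {ψ : ColPattern m → RapidityField K₀}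
    (hψ : ∀ Q', ∑ Q, ipTransferMatrixW m (genC K₀ q) (genW K₀) (genZ K₀) Q Q' * ψ Q = ψ Q') (Q' : ColPattern m) :
    ∑ Q, ipTransferMatrixW m (genC K₀ q) (genW K₀) (genZ K₀) Q Q' * genInv K₀ (2 * m + 1) (ψ Q) =
      genInv K₀ (2 * m + 1) (ψ Q') := by
  conv_rhs => rw [← hψ Q', map_sum]
  refine Finset.sum_congr rfl fun Q _ => ?_
  rw [map_mul, genInv_ipTransferMatrixW_top]

/-- **Reflected fixed vectors are fixed** (bottom reflection `z_1 → 1/z_1`). [folklore] -/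
theorem fixed_genInv_bottom {q : K₀} {ψ : ColPattern m → RapidityField K₀}
    (hψ : ∀ Q', ∑ Q, ipTransferMatrixW m (genC K₀ q) (genW K₀) (genZ K₀) Q Q' * ψ Q = ψ Q') (Q' : ColPattern m) :
    ∑ Q, ipTransferMatrixW m (genC K₀ q) (genW K₀) (genZ K₀) Q Q' * genInv K₀ 1 (ψ Q) = genInv K₀ 1 (ψ Q') := by
  conv_rhs => rw [← hψ Q', map_sum]
  refine Finset.sum_congr rfl fun Q _ => ?_
  by_cases hQ : ψ Q = 0
  · simp [hQ]
  · rw [map_mul, genInv_ipTransferMatrixW_bottom q ((isValid_of_fixed_ne_zero hψ hQ).bottom (by norm_num))]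

/-- From proportionality to a scalar factor. [folklore] -/
theorem exists_scalar_of_proportional {ψ φ : ColPattern m → RapidityField K₀}
    (hprop : ∀ k, φ k • ψ = ψ k • φ) (hψ0 : ψ ≠ 0) : ∃ c : RapidityField K₀, ∀ Q, φ Q = c * ψ Q := by
  obtain ⟨k, hk⟩ : ∃ k, ψ k ≠ 0 := by
    by_contra h
    simp only [not_exists, not_not] at h
    exact hψ0 (funext h)
  refine ⟨φ k / ψ k, fun Q => ?_⟩
  have := congrFun (hprop k) Q
  simp only [Pi.smul_apply, smul_eq_mul] at this
  field_simp
  linear_combination -this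

end ProjectiveQKZ

/-! ### Over `ℂ`: the ground state solves the qKZ system up to scalars -/

section GroundStateQKZ

open Literature.Probability.LatticeModels.TemperleyLieb

/-- **The generic ground state satisfies the `i`-th exchange equation up to a scalar** (odd
`i = 2j+1`): `[q z_{i+1}/z_i] Ψ(Q) - [z_i/z_{i+1}] Σ_{e_i Q₀ ≡ Q} Ψ(Q₀) = c · σ_i(Ψ(Q))` for some
`c ∈ Frac ℂ[X]` — IP12's "the interlacing relations yield the qKZ equation" before the normalisation
that makes `c = [q z_i/z_{i+1}]`. [cite: IkhlefPonsaing2012, §3.4] -/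
theorem groundState_exchange_odd_upToScalar {q : ℂ} (hq : q ^ 2 + q + 1 = 0)
    {ψ : ColPattern m → RapidityField ℂ}
    (hψ : ∀ Q', ∑ Q, ipTransferMatrixW m (genC ℂ q) (genW ℂ) (genZ ℂ) Q Q' * ψ Q = ψ Q') (hψ0 : ψ ≠ 0)
    (j j1 : Fin (m + 1)) (hj1 : (j1 : ℕ) = j + 1) :
    ∃ c : RapidityField ℂ, ∀ Q,
      qbr (genC ℂ q * genZ ℂ (2 * j + 2) / genZ ℂ (2 * j + 1)) * ψ Q -
          qbr (genZ ℂ (2 * j + 1) / genZ ℂ (2 * j + 2)) *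
            ∑ Q₀ ∈ Finset.univ.filter (fun Q₀ => lump (cpJoin j j1 Q₀) = Q), ψ Q₀ =
        c * genSwap ℂ (2 * j + 1) (ψ Q) := by
  set Φ : ColPattern m → RapidityField ℂ := fun Q =>
    qbr (genC ℂ q * genZ ℂ (2 * j + 2) / genZ ℂ (2 * j + 1)) * ψ Q -
      qbr (genZ ℂ (2 * j + 1) / genZ ℂ (2 * j + 2)) *
        ∑ Q₀ ∈ Finset.univ.filter (fun Q₀ => lump (cpJoin j j1 Q₀) = Q), ψ Q₀ with hΦ
  have hΦfix : ∀ Q', ∑ Q, ipTransferMatrixW m (genC ℂ q) (genW ℂ) (zswap (genZ ℂ) (2 * j + 1)) Q Q' * Φ Q = Φ Q' :=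
    fixed_exchange_odd hq hψ j j1 hj1
  have hτfix := fixed_genSwap_symm (q := q) (by omega : 2 * (j : ℕ) + 1 ≠ 0) hΦfix
  obtain ⟨c, hc⟩ := exists_scalar_of_proportional
    (fun k => ipTransferMatrixW_fixed_proportional hq hψ hτfix k) hψ0
  refine ⟨genSwap ℂ (2 * j + 1) c, fun Q => ?_⟩
  have := congrArg (genSwap ℂ (2 * j + 1)) (hc Q)
  rwa [RingEquiv.apply_symm_apply, map_mul] at this

/-- The same at an even level `i = 2b`. [cite: IkhlefPonsaing2012, §3.4] -/
theorem groundState_exchange_even_upToScalar {q : ℂ} (hq : q ^ 2 + q + 1 = 0)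
    {ψ : ColPattern m → RapidityField ℂ}
    (hψ : ∀ Q', ∑ Q, ipTransferMatrixW m (genC ℂ q) (genW ℂ) (genZ ℂ) Q Q' * ψ Q = ψ Q') (hψ0 : ψ ≠ 0)
    (b0 b : Fin (m + 1)) (hb0 : (b : ℕ) = b0 + 1) :
    ∃ c : RapidityField ℂ, ∀ Q,
      qbr (genC ℂ q * genZ ℂ (2 * b + 1) / genZ ℂ (2 * b)) * ψ Q -
          qbr (genZ ℂ (2 * b) / genZ ℂ (2 * b + 1)) *
            ∑ Q₀ ∈ Finset.univ.filter (fun Q₀ => lump (cpIsolate b Q₀) = Q), ψ Q₀ =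
        c * genSwap ℂ (2 * b) (ψ Q) := by
  set Φ : ColPattern m → RapidityField ℂ := fun Q =>
    qbr (genC ℂ q * genZ ℂ (2 * b + 1) / genZ ℂ (2 * b)) * ψ Q -
      qbr (genZ ℂ (2 * b) / genZ ℂ (2 * b + 1)) *
        ∑ Q₀ ∈ Finset.univ.filter (fun Q₀ => lump (cpIsolate b Q₀) = Q), ψ Q₀ with hΦ
  have hΦfix : ∀ Q', ∑ Q, ipTransferMatrixW m (genC ℂ q) (genW ℂ) (zswap (genZ ℂ) (2 * b)) Q Q' * Φ Q = Φ Q' :=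
    fixed_exchange_even hq hψ b0 b hb0
  have hτfix := fixed_genSwap_symm (q := q) (by omega : 2 * (b : ℕ) ≠ 0) hΦfix
  obtain ⟨c, hc⟩ := exists_scalar_of_proportional
    (fun k => ipTransferMatrixW_fixed_proportional hq hψ hτfix k) hψ0
  refine ⟨genSwap ℂ (2 * b) c, fun Q => ?_⟩
  have := congrArg (genSwap ℂ (2 * b)) (hc Q)
  rwa [RingEquiv.apply_symm_apply, map_mul] at this

/-- **The generic ground state is an eigenvector of the two boundary reflections.**
[cite: IkhlefPonsaing2012, §3.4] -/
theorem groundState_reflect_upToScalar {q : ℂ} (hq : q ^ 2 + q + 1 = 0)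
    {ψ : ColPattern m → RapidityField ℂ}
    (hψ : ∀ Q', ∑ Q, ipTransferMatrixW m (genC ℂ q) (genW ℂ) (genZ ℂ) Q Q' * ψ Q = ψ Q') (hψ0 : ψ ≠ 0) :
    (∃ d : RapidityField ℂ, ∀ Q, genInv ℂ 1 (ψ Q) = d * ψ Q) ∧
      ∃ d : RapidityField ℂ, ∀ Q, genInv ℂ (2 * m + 1) (ψ Q) = d * ψ Q :=
  ⟨exists_scalar_of_proportional
      (fun k => ipTransferMatrixW_fixed_proportional hq hψ (fixed_genInv_bottom hψ) k) hψ0,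
    exists_scalar_of_proportional
      (fun k => ipTransferMatrixW_fixed_proportional hq hψ (fixed_genInv_top hψ) k) hψ0⟩

end GroundStateQKZ

/-! ### The generic ground state lives on the planar sector -/

section PlanarSupport

open _root_.Matrix Literature.Probability.LatticeModels.TemperleyLieb

variable {K : Type*} [Field K]

/-- The weighted layer kernel preserves planarity. [cite: IkhlefPonsaing2012, §3.1] -/
theorem ipTransferW_eq_zero_of_not_isPlanar (c : ℤ) (p : Sym2 (Site 2) → K) {P P' : ColPattern m}
    (hP : IsValid c P) (hPl : IsPlanar P) (h : ¬ IsPlanar P') : ipTransferW m c p P P' = 0 := by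
  unfold ipTransferW
  refine Finset.sum_eq_zero fun U hU => ?_
  rw [if_neg]
  rintro rfl
  exact h (colUpdate_isPlanar hP hPl (adj_of_edgeFn c (Finset.mem_powerset.1 hU)))

/-- **`t(w; z⃗)` preserves the valid planar sector.** [cite: IkhlefPonsaing2012, §3.1] -/
theorem ipTransferMatrixW_eq_zero_of_not (q w : K) (z : ℕ → K) {Q Q'' : ColPattern m}
    (hQ : IsValid 0 Q) (hQl : IsPlanar Q) (h : ¬ (IsValid 0 Q'' ∧ IsPlanar Q'')) :
    ipTransferMatrixW m q w z Q Q'' = 0 := by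
  rw [ipTransferMatrixW_eq]
  unfold ipTwoLayerW
  refine Finset.sum_eq_zero fun P₁ _ => Finset.sum_eq_zero fun P₂ hP₂ => ?_
  have hP₂Q : lump P₂ = Q'' := (Finset.mem_filter.1 hP₂).2
  by_cases h0 : ipTransferW m 0 (ipRowWeight q w z 0) Q P₁ = 0
  · rw [h0, zero_mul]
  by_cases h1 : ipTransferW m 1 (ipRowWeight q w z 1) P₁ P₂ = 0
  · rw [h1, mul_zero]
  exfalso
  have hv1 : IsValid 1 P₁ := by simpa using isValid_of_ipTransferW_ne_zero h0
  have hpl1 : IsPlanar P₁ := by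
    by_contra hc; exact h0 (ipTransferW_eq_zero_of_not_isPlanar 0 _ hQ hQl hc)
  have hv2 : IsValid 2 P₂ := by simpa using isValid_of_ipTransferW_ne_zero h1
  have hpl2 : IsPlanar P₂ := by
    by_contra hc; exact h1 (ipTransferW_eq_zero_of_not_isPlanar 1 _ hv1 hpl1 hc)
  apply h
  rw [← hP₂Q]
  exact ⟨isValid_zero_of_isValid_two (lump_isValid hv2), lump_isPlanar hv2 hpl2⟩

/-- **A nonzero `t`-fixed vector supported on the valid planar sector exists** (over any field in
which `t - 1` restricted to that sector is singular — always, by row sums). [cite: IkhlefPonsaing2012, §3.4] -/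
theorem exists_fixed_planar (q w : K) (z : ℕ → K) :
    ∃ ψ : ColPattern m → K, ψ ≠ 0 ∧ (∀ Q, ψ Q ≠ 0 → IsValid 0 Q ∧ IsPlanar Q) ∧
      ∀ Q', ∑ Q, ipTransferMatrixW m q w z Q Q' * ψ Q = ψ Q' := by
  classical
  -- the sector and the restricted matrix
  set pS : ColPattern m → Prop := fun Q => IsValid 0 Q ∧ IsPlanar Q with hpS
  set T : Matrix {Q // pS Q} {Q // pS Q} K := Matrix.of fun a b => ipTransferMatrixW m q w z a.1 b.1 with hT
  -- sums over the sector
  have hsub : ∀ g : ColPattern m → K, ∑ b : {Q // pS Q}, g b.1 = ∑ Q, if pS Q then g Q else 0 := by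
    intro g
    rw [← Finset.sum_filter, ← Finset.sum_subtype (Finset.univ.filter pS) (by simp)]
  -- row sums of `T` are `1`
  have hrow : ∀ a : {Q // pS Q}, ∑ b : {Q // pS Q}, T a b = 1 := by
    intro a
    have h1 : ∑ Q'', ipTransferMatrixW m q w z a.1 Q'' = 1 := by
      simp only [ipTransferMatrixW_eq]; exact sum_ipTwoLayerW _ _ _
    simp only [hT, Matrix.of_apply]
    rw [hsub (fun Q'' => ipTransferMatrixW m q w z a.1 Q''), ← h1]
    refine Finset.sum_congr rfl fun Q'' _ => ?_
    split_ifs with hmem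
    · rfl
    · exact (ipTransferMatrixW_eq_zero_of_not q w z a.2.1 a.2.2 hmem).symm
  -- hence `T - 1` is singular and has a nonzero left null vector
  have a₀ : {Q // pS Q} := ⟨colInit m 0, colInit_isValid (m := m) 0, colInit_isPlanar 0⟩
  have hdet : (T - 1).det = 0 := by
    rw [← Matrix.exists_mulVec_eq_zero_iff]
    refine ⟨fun _ => 1, ?_, ?_⟩
    · intro h0
      have := congrFun h0 a₀
      simp at this
    · funext a
      rw [sub_mulVec, one_mulVec, Pi.sub_apply, Pi.zero_apply, sub_eq_zero, mulVec, dotProduct]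
      simp only [mul_one]
      exact hrow a
  obtain ⟨φ, hφ0, hφ⟩ := Matrix.exists_vecMul_eq_zero_iff.2 hdet
  -- extend by zero
  set ψ : ColPattern m → K := fun Q => if h : pS Q then φ ⟨Q, h⟩ else 0 with hψ
  have hψS : ∀ a : {Q // pS Q}, ψ a.1 = φ a := fun a => by simp only [hψ, dif_pos a.2]
  have hψN : ∀ Q, ¬ pS Q → ψ Q = 0 := fun Q h => by simp only [hψ, dif_neg h]
  refine ⟨ψ, ?_, ?_, ?_⟩
  · intro h0
    apply hφ0
    funext a
    rw [← hψS a, h0, Pi.zero_apply, Pi.zero_apply]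
  · intro Q hQ
    by_contra hc
    exact hQ (hψN Q hc)
  · intro Q'
    -- the sum over all `Q` reduces to the sector
    have hsum : ∑ Q, ipTransferMatrixW m q w z Q Q' * ψ Q =
        ∑ a : {Q // pS Q}, ipTransferMatrixW m q w z a.1 Q' * φ a := by
      have := hsub (fun Q => ipTransferMatrixW m q w z Q Q' * ψ Q)
      simp only [hψS] at this
      rw [this]
      refine Finset.sum_congr rfl fun Q _ => ?_
      split_ifs with hmem
      · rfl
      · rw [hψN Q hmem, mul_zero]
    rw [hsum]
    by_cases hQ' : pS Q'
    · rw [show ψ Q' = φ ⟨Q', hQ'⟩ from hψS ⟨Q', hQ'⟩]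
      have := congrFun hφ ⟨Q', hQ'⟩
      rw [vecMul_sub, vecMul_one, Pi.sub_apply, Pi.zero_apply, sub_eq_zero, vecMul, dotProduct] at this
      rw [← this]
      refine Finset.sum_congr rfl fun a _ => ?_
      rw [hT, Matrix.of_apply, mul_comm]
    · rw [hψN Q' hQ']
      refine Finset.sum_eq_zero fun a _ => ?_
      rw [ipTransferMatrixW_eq_zero_of_not q w z a.2.1 a.2.2 hQ', zero_mul]

/-- **The generic ground state is supported on valid planar patterns** (hence, being supported on
lump-fixed ones, on the connectivity basis `LP_L`). [cite: IkhlefPonsaing2012, §3.4] -/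
theorem groundState_support {q : ℂ} (hq : q ^ 2 + q + 1 = 0) {ψ : ColPattern m → RapidityField ℂ}
    (hψ : ∀ Q', ∑ Q, ipTransferMatrixW m (genC ℂ q) (genW ℂ) (genZ ℂ) Q Q' * ψ Q = ψ Q') {Q : ColPattern m}
    (h : ψ Q ≠ 0) : IsValid 0 Q ∧ IsPlanar Q ∧ lump Q = Q := by
  obtain ⟨ψ₀, hψ₀0, hsupp, hψ₀⟩ := exists_fixed_planar (m := m) (genC ℂ q) (genW ℂ) (genZ ℂ)
  obtain ⟨c, hc⟩ := exists_scalar_of_proportional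
    (fun k => ipTransferMatrixW_fixed_proportional hq hψ₀ hψ k) hψ₀0
  have hQ : ψ₀ Q ≠ 0 := by
    intro h0; exact h (by rw [hc Q, h0, mul_zero])
  refine ⟨(hsupp Q hQ).1, (hsupp Q hQ).2, ?_⟩
  -- lump-fixed: `ψ Q = Σ_P t(P, Q) ψ P` and `t` lands on lumped patterns
  rw [← hψ Q] at h
  obtain ⟨P, -, hP⟩ := Finset.exists_ne_zero_of_sum_ne_zero h
  have ht : ipTransferMatrixW m (genC ℂ q) (genW ℂ) (genZ ℂ) P Q ≠ 0 := left_ne_zero_of_mul hP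
  rw [ipTransferMatrixW_eq] at ht
  obtain ⟨P₁, -, hP₁⟩ := Finset.exists_ne_zero_of_sum_ne_zero ht
  obtain ⟨P₂, hP₂, -⟩ := Finset.exists_ne_zero_of_sum_ne_zero hP₁
  rw [← (Finset.mem_filter.1 hP₂).2, lump_lump]

end PlanarSupport

end Literature.Probability.Percolation
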